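import Summits.ResolutionOfSingularities.ResolutionOfSingularities.Theorems.RisoStrataRisoCentresResolvePCuspTools

/-!
# Route RisoStrata — crux `RisoCentresResolve` (stmt-ResolutionOfSingularities-18546), line `Sketch`:
# typed `Rtd` VANISHES along the purely inseparable family `w^p = u y^p` (characteristic `p`)

Lead c2. The crux transplants Monreal's riso-triviality dimension (arXiv:2606.12554, Def. 4.7,
Hahn-series arcs over `k((t^ℚ))`) to characteristic `p`; this file shows that the transplant
parts from characteristic `0` exactly where inseparability enters (registered sub-goal
`pcusp_not_rtd_one`; tools in `…PCuspTools.lean`, direction calculus in `…DirCalculus.lean`):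
for `char k = p`, `B = k[x^p, y, xy] ⊆ k(x,y)` (the toric surface `w^p = u y^p`, `u = x^p`,
`w = xy`; normalisation `𝔸²`, singular locus the line `y = w = 0`) and every proper ideal
`m ∋ u - c^p, y, w` with `c ≠ 0`, the route's inline `Rtd B m 1` is FALSE. Hence the letter `0`
of a riso schedule (`Cen(B,0) = ⋂ {singular m : ¬ Rtd B m 1}`) blows up this whole CURVE, and
the characteristic-`0` dimension bound `dim S_{≤d} ≤ d` (Bradley-Williams–Halupczok, Selecta
2025, 4.2.8) fails for the typed first shadow in characteristic `p` (for `w^n = u y^n`, `p ∤ n`,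
the family is étale-locally `(n lines) × 𝔾_m`, `rtd = 1`). `pc_core` is the abstract core (only
the relation `P2^p = (P0 + c^p) P1^p`, `P0 ∈ m` and the arcs `(X,Y) ↦ (X^p, Y, (C c + X) Y)` are
used); the reduction from an arbitrary presentation to the coordinates `(u - c^p, y, w)` is the
landed cotangent invariance `stub_invariance`. No definitions, no named facts.
-/

noncomputable section

set_option linter.dupNamespace false

namespace Summit.ResolutionOfSingularities.ResolutionOfSingularities.Theorems

open Summit.ResolutionOfSingularities.ResolutionOfSingularities.Theses.RisoStrata

section PCuspMain

variable {k : Type} [Field k]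

/-- **Core of `pcusp_not_rtd_one`**: no typed straightener on the coordinates
`(P0, P1, P2) = (u - c^p, y, w)` of the `p`-cusp family has a nonzero direction. Abstract over
the ambient field: only the relation `P2^p = (P0 + c^p) P1^p`, membership `P0 ∈ m`, and the
family of arcs `(X, Y) ↦ (X^p, Y, (C c + X) Y)` are used. -/
theorem pc_core (p : ℕ) [Fact p.Prime] [CharP k p] {K : Type} [Field K] [Algebra k K]
    {B : Subalgebra k K} {m : Ideal ↥B} (P0 P1 P2 : ↥B) (hP0m : P0 ∈ m) (c : k) (hc : c ≠ 0)
    (hrel : P2 ^ p = (P0 + algebraMap k ↥B (c ^ p)) * P1 ^ p)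
    (harc : ∀ X Y : HahnSeries ℚ k, 0 < X.orderTop → 0 < Y.orderTop →
      ∃ α : {α : ↥B →ₐ[k] HahnSeries ℚ k // ∀ b ∈ m, 0 < (α b).orderTop},
        α.1 P0 = X ^ p ∧ α.1 P1 = Y ∧ α.1 P2 = (HahnSeries.C c + X) * Y)
    (P : Fin 3 → ↥B) (hPP0 : P 0 = P0) (hPP1 : P 1 = P1) (hPP2 : P 2 = P2)
    (W₃ : Submodule k (Fin 3 → k)) (u : Fin 3 → k) (hu : u ∈ W₃) (hu0 : u ≠ 0)
    (φ₃ : {α : ↥B →ₐ[k] HahnSeries ℚ k // ∀ b ∈ m, 0 < (α b).orderTop} → Fin 3 → HahnSeries ℚ k)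
    (k1 : ∀ a b : {α : ↥B →ₐ[k] HahnSeries ℚ k // ∀ b ∈ m, 0 < (α b).orderTop}, a ≠ b →
      ∃ j, ∀ i, (a.1 (P j) - b.1 (P j)).orderTop <
        ((φ₃ a i - φ₃ b i) - (a.1 (P i) - b.1 (P i))).orderTop)
    (k3 : ∀ a (w : Fin 3 → HahnSeries ℚ k), (∀ i, 0 < (w i).orderTop) →
      w ∈ Submodule.span (HahnSeries ℚ k)
        ((fun u : Fin 3 → k => fun i => HahnSeries.C (u i)) '' (W₃ : Set (Fin 3 → k))) →
      ∃ b, φ₃ b = φ₃ a + w)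
    (a₀ : {α : ↥B →ₐ[k] HahnSeries ℚ k // ∀ b ∈ m, 0 < (α b).orderTop})
    (ha₀0 : a₀.1 P0 = HahnSeries.single (1 : ℚ) (1 : k) ^ p)
    (ha₀1 : a₀.1 P1 = HahnSeries.single (4 : ℚ) (1 : k))
    (ha₀2 : a₀.1 P2 = (HahnSeries.C c + HahnSeries.single (1 : ℚ) (1 : k)) * HahnSeries.single (4 : ℚ) (1 : k)) :
    False := by
  have hp2 : 2 ≤ p := (Fact.out : p.Prime).two_le
  have hp0 : p ≠ 0 := by omega
  have hpQ : (2 : ℚ) ≤ p := by exact_mod_cast hp2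
  haveI := pc_charP_hahn (k := k) p
  set cc : {α : ↥B →ₐ[k] HahnSeries ℚ k // ∀ b ∈ m, 0 < (α b).orderTop} → Fin 3 → HahnSeries ℚ k :=
    fun a i => a.1 (P i) with hcc
  have k1' : ∀ a b, a ≠ b → ∃ j, ∀ i,
      (cc a j - cc b j).orderTop < ((φ₃ a i - φ₃ b i) - (cc a i - cc b i)).orderTop := k1
  have ht1 : (0 : WithTop ℚ) < (HahnSeries.single (1 : ℚ) (1 : k)).orderTop := by
    rw [HahnSeries.orderTop_single one_ne_zero]; exact_mod_cast (one_pos : (0 : ℚ) < 1)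
  have ht4 : (0 : WithTop ℚ) < (HahnSeries.single (4 : ℚ) (1 : k)).orderTop := by
    rw [HahnSeries.orderTop_single one_ne_zero]; exact_mod_cast (by norm_num : (0 : ℚ) < 4)
  -- orders of the base arc
  have hordX : (HahnSeries.single (1 : ℚ) (1 : k)).orderTop = ((1 : ℚ) : WithTop ℚ) :=
    HahnSeries.orderTop_single one_ne_zero
  have hord4 : (HahnSeries.single (4 : ℚ) (1 : k)).orderTop = ((4 : ℚ) : WithTop ℚ) :=
    HahnSeries.orderTop_single one_ne_zero
  have ha₀0pos : 0 < (a₀.1 P0).orderTop := a₀.2 P0 hP0m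
  have ha₀1ord : (a₀.1 P1).orderTop = ((4 : ℚ) : WithTop ℚ) := by rw [ha₀1, hord4]
  have hcp : c ^ p ≠ 0 := pow_ne_zero p hc
  -- rewrite P j in terms of P0 P1 P2 inside the clauses
  have hE : ∀ β : {α : ↥B →ₐ[k] HahnSeries ℚ k // ∀ b ∈ m, 0 < (α b).orderTop},
      (HahnSeries.C (c ^ p) + β.1 P0).orderTop = 0 := fun β =>
    pc_orderTop_C_add hcp (β.2 P0 hP0m)
  by_cases hu00 : u 0 = 0
  swap
  · ----------------------------------------------------------------- Case A: u₀ ≠ 0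
    obtain ⟨b, -, hb⟩ := dir_realise k1' k3 a₀ hu hu0 (e := 9) (by norm_num)
    have hb0 := hb 0; have hb1 := hb 1; have hb2 := hb 2
    simp only [hcc, hPP0, hPP1, hPP2] at hb0 hb1 hb2
    have hΔ0 : (b.1 P0 - a₀.1 P0).orderTop = ((9 : ℚ) : WithTop ℚ) := pc_orderTop_eq_of_sub_single hu00 hb0
    have hΔ1 : ((9 : ℚ) : WithTop ℚ) ≤ (b.1 P1 - a₀.1 P1).orderTop :=
      pc_le_orderTop_of_sub (dir_le_orderTop_single 9 (u 1)) hb1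
    have hΔ2 : ((9 : ℚ) : WithTop ℚ) ≤ (b.1 P2 - a₀.1 P2).orderTop :=
      pc_le_orderTop_of_sub (dir_le_orderTop_single 9 (u 2)) hb2
    have hY : (b.1 P1).orderTop = ((4 : ℚ) : WithTop ℚ) := by
      have : b.1 P1 = HahnSeries.single (4 : ℚ) (1 : k) + (b.1 P1 - a₀.1 P1) := by rw [ha₀1]; ring
      rw [this]
      exact pc_orderTop_single_add one_ne_zero (lt_of_lt_of_le (by exact_mod_cast (by norm_num : (4 : ℚ) < 9)) hΔ1)
    exact pc_kill (pc_frob p P0 P1 P2 c hrel b.1 a₀.1) (hE a₀) hY hΔ0 hΔ1 hΔ2 (by nlinarith)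
  by_cases hcase : u 2 ^ p = c ^ p * u 1 ^ p
  swap
  · ----------------------------------------------------------------- Case B: u₀ = 0, u₂^p ≠ c^p u₁^p
    obtain ⟨b, -, hb⟩ := dir_realise k1' k3 a₀ hu hu0 (e := 1) one_pos
    have hb0 := hb 0; have hb1 := hb 1; have hb2 := hb 2
    simp only [hcc, hPP0, hPP1, hPP2, hu00, map_zero, sub_zero] at hb0 hb1 hb2
    obtain ⟨r1, e1⟩ : ∃ r1, b.1 P1 - a₀.1 P1 = HahnSeries.single (1 : ℚ) (u 1) + r1 :=
      ⟨b.1 P1 - a₀.1 P1 - HahnSeries.single (1 : ℚ) (u 1), by ring⟩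
    obtain ⟨r2, e2⟩ : ∃ r2, b.1 P2 - a₀.1 P2 = HahnSeries.single (1 : ℚ) (u 2) + r2 :=
      ⟨b.1 P2 - a₀.1 P2 - HahnSeries.single (1 : ℚ) (u 2), by ring⟩
    have hr1 : ((1 : ℚ) : WithTop ℚ) < r1.orderTop := by
      have : r1 = b.1 P1 - a₀.1 P1 - HahnSeries.single (1 : ℚ) (u 1) := by rw [e1]; ring
      rw [this]; exact hb1
    have hr2 : ((1 : ℚ) : WithTop ℚ) < r2.orderTop := by
      have : r2 = b.1 P2 - a₀.1 P2 - HahnSeries.single (1 : ℚ) (u 2) := by rw [e2]; ring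
      rw [this]; exact hb2
    have hsp1 : ∀ v : k, (HahnSeries.single (1 : ℚ) v) ^ p = HahnSeries.single ((p : ℚ) * 1) (v ^ p) := by
      intro v; rw [HahnSeries.single_pow, nsmul_eq_mul]
    have hstar' : HahnSeries.single ((p : ℚ) * 1) (u 2 ^ p) + r2 ^ p =
        (b.1 P0 - a₀.1 P0) * (b.1 P1) ^ p +
          (HahnSeries.C (c ^ p) + a₀.1 P0) * (HahnSeries.single ((p : ℚ) * 1) (u 1 ^ p) + r1 ^ p) := by
      have h := pc_frob p P0 P1 P2 c hrel b.1 a₀.1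
      rw [e1, e2] at h
      rw [add_pow_char, add_pow_char] at h
      rw [hsp1, hsp1] at h
      exact h
    have hY1 : ((1 : ℚ) : WithTop ℚ) ≤ (b.1 P1).orderTop := by
      have : b.1 P1 = (b.1 P1 - a₀.1 P1) + a₀.1 P1 := by ring
      rw [this]
      refine le_trans (le_min ?_ ?_) HahnSeries.min_orderTop_le_orderTop_add
      · exact pc_le_orderTop_of_sub (dir_le_orderTop_single 1 (u 1)) hb1
      · rw [ha₀1ord]; exact_mod_cast (by norm_num : (1 : ℚ) ≤ 4)
    have hT : (((p : ℚ) * 1 : ℚ) : WithTop ℚ) < ((b.1 P0 - a₀.1 P0) * (b.1 P1) ^ p).orderTop := by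
      have h := pc_lt_orderTop_mul hb0 (pc_le_orderTop_pow hY1 p)
      refine lt_of_le_of_lt ?_ h
      exact_mod_cast (by nlinarith : (p : ℚ) * 1 ≤ 1 + p * 1)
    have hR1 : (((p : ℚ) * 1 : ℚ) : WithTop ℚ) < (r1 ^ p).orderTop := pc_lt_orderTop_pow hr1 hp0
    have hR2 : (((p : ℚ) * 1 : ℚ) : WithTop ℚ) < (r2 ^ p).orderTop := pc_lt_orderTop_pow hr2 hp0
    exact hcase (pc_smallkill hcp hstar' hT ha₀0pos hR1 hR2)
  · ----------------------------------------------------------------- Case C: u₀ = 0, u₂^p = c^p u₁^p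
    have hu1 : u 1 ≠ 0 := by
      intro hu1
      apply hu0
      have hu2 : u 2 = 0 := by
        rw [hu1, zero_pow hp0, mul_zero] at hcase
        exact pow_eq_zero_iff hp0 |>.mp hcase
      funext i; fin_cases i
      · exact hu00
      · exact hu1
      · exact hu2
    -- translate the base arc by t • u
    have hT := dir_transport' k1' k3 a₀ hu (e₀ := (1 : ℚ)) one_pos
    obtain ⟨a', ha', hiff⟩ := hT
    have hmv := dir_of_translate k1' hu0 ha'
    obtain ⟨-, hmove⟩ := hmv
    have hm1 := hmove 1
    simp only [hcc, hPP1] at hm1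
    have hYa' : (a'.1 P1).orderTop = ((1 : ℚ) : WithTop ℚ) := by
      have : a'.1 P1 = HahnSeries.single (1 : ℚ) (u 1) +
          (HahnSeries.single (4 : ℚ) (1 : k) + (a'.1 P1 - a₀.1 P1 - HahnSeries.single (1 : ℚ) (u 1))) := by
        rw [ha₀1]; ring
      rw [this]
      refine pc_orderTop_single_add hu1 (lt_orderTop_add ?_ hm1)
      rw [hord4]; exact_mod_cast (by norm_num : (1 : ℚ) < 4)
    -- the witness at the base arc: direction (1,0,0) at order 3
    have hs : (0 : WithTop ℚ) < (HahnSeries.single (1 : ℚ) (1 : k) + HahnSeries.single ((3 : ℚ) / p) (1 : k)).orderTop := by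
      refine lt_orderTop_add ht1 ?_
      rw [HahnSeries.orderTop_single one_ne_zero]
      exact_mod_cast (by positivity : (0 : ℚ) < 3 / p)
    obtain ⟨b₃, hb₃0, hb₃1, hb₃2⟩ := harc _ _ hs ht4
    have hsp : (HahnSeries.single ((3 : ℚ) / p) (1 : k)) ^ p = HahnSeries.single (3 : ℚ) (1 : k) := by
      rw [HahnSeries.single_pow, one_pow, nsmul_eq_mul, mul_div_cancel₀]
      exact_mod_cast hp0
    obtain ⟨w, hw0, hw1, hw2⟩ : ∃ w : Fin 3 → HahnSeries ℚ k,
        w 0 = HahnSeries.single (3 : ℚ) (1 : k) ∧ w 1 = 0 ∧ w 2 = 0 :=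
      ⟨![HahnSeries.single (3 : ℚ) (1 : k), 0, 0], rfl, rfl, rfl⟩
    have hw : ∀ i, ((3 : ℚ) : WithTop ℚ) ≤ (w i).orderTop := by
      intro i; fin_cases i
      · show ((3 : ℚ) : WithTop ℚ) ≤ (w 0).orderTop
        rw [hw0]; exact HahnSeries.orderTop_single_le
      · show ((3 : ℚ) : WithTop ℚ) ≤ (w 1).orderTop
        rw [hw1, HahnSeries.orderTop_zero]; exact le_top
      · show ((3 : ℚ) : WithTop ℚ) ≤ (w 2).orderTop
        rw [hw2, HahnSeries.orderTop_zero]; exact le_top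
    have hb₃ne : b₃ ≠ a₀ := by
      intro h
      have : b₃.1 P0 = a₀.1 P0 := by rw [h]
      rw [hb₃0, ha₀0, add_pow_char, hsp, add_eq_left] at this
      exact one_ne_zero (HahnSeries.single_eq_zero_iff.mp this)
    have hwit : ∀ i, ((3 : ℚ) : WithTop ℚ) < (cc b₃ i - cc a₀ i - w i).orderTop := by
      intro i; fin_cases i
      · show ((3 : ℚ) : WithTop ℚ) < (cc b₃ 0 - cc a₀ 0 - w 0).orderTop
        simp only [hcc, hPP0, hw0, hb₃0, ha₀0]
        rw [add_pow_char, hsp, add_sub_cancel_left, sub_self, HahnSeries.orderTop_zero]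
        exact WithTop.coe_lt_top _
      · show ((3 : ℚ) : WithTop ℚ) < (cc b₃ 1 - cc a₀ 1 - w 1).orderTop
        simp only [hcc, hPP1, hw1, hb₃1, ha₀1]
        rw [sub_self, sub_zero, HahnSeries.orderTop_zero]
        exact WithTop.coe_lt_top _
      · show ((3 : ℚ) : WithTop ℚ) < (cc b₃ 2 - cc a₀ 2 - w 2).orderTop
        simp only [hcc, hPP2, hw2, hb₃2, ha₀2]
        have : (HahnSeries.C c + (HahnSeries.single (1 : ℚ) (1 : k) + HahnSeries.single ((3 : ℚ) / p) 1)) *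
            HahnSeries.single (4 : ℚ) (1 : k) -
            (HahnSeries.C c + HahnSeries.single (1 : ℚ) 1) * HahnSeries.single (4 : ℚ) 1 - 0 =
            HahnSeries.single ((3 : ℚ) / p) (1 : k) * HahnSeries.single (4 : ℚ) (1 : k) := by ring
        rw [this, HahnSeries.single_mul_single, mul_one, HahnSeries.orderTop_single one_ne_zero]
        exact_mod_cast (by linarith [(by positivity : (0 : ℚ) < 3 / p)] : (3 : ℚ) < 3 / p + 4)
    obtain ⟨b', -, hb'⟩ := (hiff 3 w hw).mp ⟨b₃, hb₃ne, hwit⟩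
    have hb'0 := hb' 0; have hb'1 := hb' 1; have hb'2 := hb' 2
    simp only [hcc, hPP0, hPP1, hPP2, hw0, hw1, hw2, sub_zero] at hb'0 hb'1 hb'2
    have hΔ0 : (b'.1 P0 - a'.1 P0).orderTop = ((3 : ℚ) : WithTop ℚ) := pc_orderTop_eq_of_sub_single one_ne_zero hb'0
    have hY : (b'.1 P1).orderTop = ((1 : ℚ) : WithTop ℚ) := by
      have hlt : (a'.1 P1).orderTop < (b'.1 P1 - a'.1 P1).orderTop := by
        rw [hYa']; exact lt_of_lt_of_le (by exact_mod_cast (by norm_num : (1 : ℚ) < 3)) hb'1.le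
      have : b'.1 P1 = a'.1 P1 + (b'.1 P1 - a'.1 P1) := by ring
      rw [this, HahnSeries.orderTop_add_eq_left hlt, hYa']
    exact pc_kill (pc_frob p P0 P1 P2 c hrel b'.1 a'.1) (hE a') hY hΔ0 hb'1.le hb'2.le (by nlinarith)


/-- **Typed `Rtd` vanishes along the purely inseparable family `w^p = u y^p`** (lead c2, the
characteristic-`p` collapse of the cut alphabet).  Let `k` have characteristic `p`,
`K = k(X₀, X₁)`, `x = X₀`, `y = X₁`, and `B = k[x^p, y, xy] ⊆ K` (the toric surface
`Spec k[ℕ⟨(p,0),(0,1),(1,1)⟩]`, relation `w^p = u y^p` for `u = x^p`, `w = xy`; its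
normalisation is the affine plane and its singular locus is the line `y = w = 0`).  For every
`c ≠ 0` and every proper ideal `m` of `B` containing `u - c^p`, `y`, `w` (the closed point
`u = c^p` of that line), the route's typed riso-triviality predicate `Rtd B m 1` FAILS: the
Hahn-series arc space of `B` at `m` is not risometrically translation-invariant along any line.
(In characteristic `0` the analogous family `w^n = u y^n` is étale-locally a product with a line
and has `rtd = 1`.)  Hence in characteristic `p` the letter `0` of a riso schedule blows up this
whole CURVE: the first shadow `S_{≤0}` is not zero-dimensional (contrast BWH, Selecta 2025,
4.2.8, `dim S_{≤d} ≤ d` in equicharacteristic `0`).  Proof: cotangent invariance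
(`stub_invariance`) puts the straightener on the coordinates `(u - c^p, y, w)`; the Frobenius
identity `(Δw)^p = Δu · y^p + u · (Δy)^p` (`pc_frob`) and the direction calculus
(`dir_realise`, `dir_transport`) kill every direction `(u₀,u₁,u₂)`: `u₀ ≠ 0` at a large order,
`u₂^p ≠ c^p u₁^p` at a small order, and `u₂^p = c^p u₁^p`, `u₁ ≠ 0` by transporting the
direction `(1,0,0)` (realised at order `3` from the base arc `(t, t⁴)`, not realisable from its
translate with `v y = 1`). [folklore] -/
theorem pcusp_not_rtd_one : ∀ (p : ℕ) [Fact p.Prime] (k : Type) [Field k] [CharP k p] (c : k), c ≠ 0 → ∀ (B : Subalgebra k (FractionRing (MvPolynomial (Fin 2) k))), B = Algebra.adjoin k {(algebraMap (MvPolynomial (Fin 2) k) (FractionRing (MvPolynomial (Fin 2) k)) (MvPolynomial.X 0)) ^ p, algebraMap (MvPolynomial (Fin 2) k) (FractionRing (MvPolynomial (Fin 2) k)) (MvPolynomial.X 1), algebraMap (MvPolynomial (Fin 2) k) (FractionRing (MvPolynomial (Fin 2) k)) (MvPolynomial.X 0) * algebraMap (MvPolynomial (Fin 2) k) (FractionRing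 (MvPolynomial (Fin 2) k)) (MvPolynomial.X 1)} → ∀ (m : Ideal ↥B), m ≠ ⊤ → (∀ b : ↥B, ((b : FractionRing (MvPolynomial (Fin 2) k)) = (algebraMap (MvPolynomial (Fin 2) k) (FractionRing (MvPolynomial (Fin 2) k)) (MvPolynomial.X 0)) ^ p - algebraMap k (FractionRing (MvPolynomial (Fin 2) k)) (c ^ p) ∨ (b : FractionRing (MvPolynomial (Fin 2) k)) = algebraMap (MvPolynomial (Fin 2) k) (FractionRing (MvPolynomial (Fin 2) k)) (MvPolynomial.X 1) ∨ (b : FractionRing (MvPolynomial (Fin 2) k)) = algebraMap (MvPolynomial (Fin 2) k) (FractionRing (MvPolynomial (Fin 2) k)) (MvPolynomial.X 0) * algebraMap (MvPolynomial (Fin 2) k) (FractionRing (MvPolynomial (Fin 2) k)) (MvPolynomial.X 1)) → b ∈ m) → ¬ ∃ (n : ℕ) (g : Fin n → ↥B), (∀ i, g i ∈ m) ∧ Algebra.adjoin k (Set.range fun i => (g i : FractionRing (MvPolynomial (Fin 2) k))) = B ∧ ∃ W : Submodule k (Fin n → k), 1 ≤ Module.finrank k ↥W ∧ ∃ φ :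 {α : ↥B →ₐ[k] HahnSeries ℚ k // ∀ b ∈ m, 0 < (α b).orderTop} → (Fin n → HahnSeries ℚ k), (∀ a b : {α : ↥B →ₐ[k] HahnSeries ℚ k // ∀ b ∈ m, 0 < (α b).orderTop}, a ≠ b → ∃ j, ∀ i, (a.1 (g j) - b.1 (g j)).orderTop < ((φ a i - φ b i) - (a.1 (g i) - b.1 (g i))).orderTop) ∧ (∀ a i, 0 < (φ a i).orderTop) ∧ (∀ a, ∀ w : Fin n → HahnSeries ℚ k, (∀ i, 0 < (w i).orderTop) → w ∈ Submodule.span (HahnSeries ℚ k) ((fun u : Fin n → k => fun i => HahnSeries.C (u i)) '' (W : Set (Fin n → k))) → ∃ b, φ b = φ a + w) := by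
  intro p _ k _ _ c hc B hB m hm hPm
  rintro ⟨n, g, hg, hgK, W, hW, φ, h1, h2, h3⟩
  set K := FractionRing (MvPolynomial (Fin 2) k) with hKdef
  set x : K := algebraMap (MvPolynomial (Fin 2) k) K (MvPolynomial.X 0) with hxdef
  set y : K := algebraMap (MvPolynomial (Fin 2) k) K (MvPolynomial.X 1) with hydef
  have hp2 : 2 ≤ p := (Fact.out : p.Prime).two_le
  have hp0 : p ≠ 0 := by omega
  have hpQ : (2 : ℚ) ≤ p := by exact_mod_cast hp2
  haveI := pc_charP_hahn (k := k) p
  -- the polynomial ring inside K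
  set ι := IsScalarTower.toAlgHom k (MvPolynomial (Fin 2) k) K with hιdef
  have hι : ∀ q, ι q = algebraMap (MvPolynomial (Fin 2) k) K q := fun q => rfl
  have hcK : algebraMap k K (c ^ p) = algebraMap (MvPolynomial (Fin 2) k) K
      (MvPolynomial.C (c ^ p)) := by
    rw [IsScalarTower.algebraMap_apply k (MvPolynomial (Fin 2) k) K, MvPolynomial.algebraMap_eq]
  -- memberships
  have hxpB : x ^ p ∈ B := hB ▸ Algebra.subset_adjoin (by simp)
  have hyB : y ∈ B := hB ▸ Algebra.subset_adjoin (by simp)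
  have hxyB : x * y ∈ B := hB ▸ Algebra.subset_adjoin (by simp)
  -- the three coordinates
  obtain ⟨P0, hP0K⟩ : ∃ P0 : ↥B, (P0 : K) = x ^ p - algebraMap k K (c ^ p) :=
    ⟨⟨x ^ p, hxpB⟩ - algebraMap k ↥B (c ^ p), by simp [Subalgebra.coe_algebraMap]; rfl⟩
  set P1 : ↥B := ⟨y, hyB⟩ with hP1def
  set P2 : ↥B := ⟨x * y, hxyB⟩ with hP2def
  have hP1K : (P1 : K) = y := rfl
  have hP2K : (P2 : K) = x * y := rfl
  have hP0m : P0 ∈ m := hPm _ (Or.inl hP0K)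
  have hP1m : P1 ∈ m := hPm _ (Or.inr (Or.inl hP1K))
  have hP2m : P2 ∈ m := hPm _ (Or.inr (Or.inr hP2K))
  obtain ⟨P, hPP0, hPP1, hPP2⟩ : ∃ P : Fin 3 → ↥B, P 0 = P0 ∧ P 1 = P1 ∧ P 2 = P2 :=
    ⟨![P0, P1, P2], rfl, rfl, rfl⟩
  have hPm' : ∀ j, P j ∈ m := by
    intro j; fin_cases j
    · exact hPP0 ▸ hP0m
    · exact hPP1 ▸ hP1m
    · exact hPP2 ▸ hP2m
  -- relation  P2^p = (P0 + c^p) * P1^p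
  have hrel : P2 ^ p = (P0 + algebraMap k ↥B (c ^ p)) * P1 ^ p := by
    apply Subtype.ext
    have e0 : ((P0 + algebraMap k ↥B (c ^ p) : ↥B) : K) = x ^ p := by
      rw [Subalgebra.coe_add, Subalgebra.coe_algebraMap, hP0K]; exact sub_add_cancel _ _
    rw [Subalgebra.coe_mul, SubmonoidClass.coe_pow, SubmonoidClass.coe_pow, e0, hP2K, hP1K, mul_pow]
  -- B sits inside the polynomial ring
  have hBle : B ≤ ι.range := by
    rw [hB, Algebra.adjoin_le_iff]
    intro z hz
    simp only [Set.mem_insert_iff, Set.mem_singleton_iff] at hz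
    rcases hz with rfl | rfl | rfl
    · exact ⟨MvPolynomial.X 0 ^ p, by rw [map_pow]; rfl⟩
    · exact ⟨MvPolynomial.X 1, rfl⟩
    · exact ⟨MvPolynomial.X 0 * MvPolynomial.X 1, by rw [map_mul]; rfl⟩
  -- the coordinates generate B
  have hPgenK : Algebra.adjoin k (Set.range fun i => (P i : K)) = B := by
    apply le_antisymm
    · rw [Algebra.adjoin_le_iff]
      rintro _ ⟨i, rfl⟩
      exact (P i).2
    · have h0 : (P0 : K) ∈ Algebra.adjoin k (Set.range fun i => (P i : K)) :=
        Algebra.subset_adjoin ⟨0, by simp only [hPP0]⟩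
      have h1' : (P1 : K) ∈ Algebra.adjoin k (Set.range fun i => (P i : K)) :=
        Algebra.subset_adjoin ⟨1, by simp only [hPP1]⟩
      have h2' : (P2 : K) ∈ Algebra.adjoin k (Set.range fun i => (P i : K)) :=
        Algebra.subset_adjoin ⟨2, by simp only [hPP2]⟩
      conv_lhs => rw [hB]
      rw [Algebra.adjoin_le_iff]
      intro z hz
      simp only [Set.mem_insert_iff, Set.mem_singleton_iff] at hz
      rcases hz with rfl | rfl | rfl
      · have : x ^ p = (P0 : K) + algebraMap k K (c ^ p) := by rw [hP0K, sub_add_cancel]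
        rw [this]
        exact add_mem h0 (Subalgebra.algebraMap_mem _ _)
      · exact hP1K ▸ h1'
      · exact hP2K ▸ h2'
  have hPgen : Algebra.adjoin k (Set.range P) = ⊤ := adjoin_range_eq_top_of_adjoin_coe_eq B P hPgenK
  -- arcs through (X₀, X₁) ↦ (c + X, Y)
  have harc : ∀ X Y : HahnSeries ℚ k, 0 < X.orderTop → 0 < Y.orderTop →
      ∃ α : {α : ↥B →ₐ[k] HahnSeries ℚ k // ∀ b ∈ m, 0 < (α b).orderTop},
        α.1 P0 = X ^ p ∧ α.1 P1 = Y ∧ α.1 P2 = (HahnSeries.C c + X) * Y := by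
    intro X Y hX hY
    obtain ⟨α, hα⟩ := pc_exists_arc c X Y B hBle
    have hv0 : α P0 = X ^ p := by
      rw [hα P0 (MvPolynomial.X 0 ^ p - MvPolynomial.C (c ^ p))
        (by rw [map_sub, map_pow, hP0K, hcK])]
      rw [map_sub, map_pow, MvPolynomial.aeval_X, MvPolynomial.aeval_C, arcEquiv_algebraMap_eq_C,
        Matrix.cons_val_zero, add_pow_char, ← map_pow, add_sub_cancel_left]
    have hv1 : α P1 = Y := by
      rw [hα P1 (MvPolynomial.X 1) (by rw [hP1K])]
      rw [MvPolynomial.aeval_X]; rfl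
    have hv2 : α P2 = (HahnSeries.C c + X) * Y := by
      rw [hα P2 (MvPolynomial.X 0 * MvPolynomial.X 1) (by rw [hP2K, map_mul])]
      rw [map_mul, MvPolynomial.aeval_X, MvPolynomial.aeval_X]; rfl
    have hpos0 : 0 < (α P0).orderTop := by
      have h := pc_lt_orderTop_pow (x := X) (a := 0) (by exact_mod_cast hX) hp0
      rw [mul_zero] at h
      rw [hv0]; exact_mod_cast h
    have hpos1 : 0 < (α P1).orderTop := hv1 ▸ hY
    have hpos2 : 0 < (α P2).orderTop := by
      rw [hv2, HahnSeries.orderTop_mul, pc_orderTop_C_add hc hX, zero_add]; exact hY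
    have hposP : ∀ j, 0 < (α (P j)).orderTop := by
      intro j; fin_cases j
      · exact hPP0 ▸ hpos0
      · exact hPP1 ▸ hpos1
      · exact hPP2 ▸ hpos2
    have hnonneg : ∀ b : ↥B, 0 ≤ (α b).orderTop :=
      sqdom_orderTop_nonneg P hPgen α (fun j => (hposP j).le)
    refine ⟨⟨α, ?_⟩, hv0, hv1, hv2⟩
    intro b hb
    -- b ≡ const mod (P); the constant dies because m is proper
    obtain ⟨d, hd⟩ := fin_residue (Ideal.span (Set.range P)) P
      (fun j => Ideal.subset_span ⟨j, rfl⟩) hPgen b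
    have hspan_le : Ideal.span (Set.range P) ≤ m := Ideal.span_le.mpr (by rintro _ ⟨j, rfl⟩; exact hPm' j)
    have hd0 : d = 0 := by
      by_contra hd0
      apply hm
      have hdm : algebraMap k ↥B d ∈ m := by
        have : algebraMap k ↥B d = b - (b - algebraMap k ↥B d) := by ring
        rw [this]
        exact sub_mem hb (hspan_le hd)
      exact m.eq_top_of_isUnit_mem hdm ((IsUnit.mk0 d hd0).map (algebraMap k ↥B))
    rw [hd0, map_zero, sub_zero] at hd
    obtain ⟨r, hr⟩ := Ideal.mem_span_range_iff_exists_fun.mp hd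
    rw [← hr, map_sum]
    refine lt_orderTop_sum (c := 0) Finset.univ _ fun j _ => ?_
    rw [map_mul]
    refine lt_of_lt_of_le ?_ HahnSeries.orderTop_add_le_mul
    exact lt_of_lt_of_le (hposP j) (le_add_of_nonneg_left (hnonneg (r j)))
  -- the straightener in the coordinates P (cotangent invariance)
  have hgtop : Algebra.adjoin k (Set.range g) = ⊤ := adjoin_range_eq_top_of_adjoin_coe_eq B g hgK
  have hN : ∀ j : Fin 3, ∃ N : Fin n → k, P j - ∑ j', algebraMap k ↥B (N j') * g j' ∈ m ^ 2 :=
    fun j => cotspan_firstOrder_of_mem m hm g hg hgtop (P j) (hPm' j)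
  choose N hN using hN
  -- the base arc (t, t⁴)
  have ht1 : (0 : WithTop ℚ) < (HahnSeries.single (1 : ℚ) (1 : k)).orderTop := by
    rw [HahnSeries.orderTop_single one_ne_zero]; exact_mod_cast (one_pos : (0 : ℚ) < 1)
  have ht4 : (0 : WithTop ℚ) < (HahnSeries.single (4 : ℚ) (1 : k)).orderTop := by
    rw [HahnSeries.orderTop_single one_ne_zero]; exact_mod_cast (by norm_num : (0 : ℚ) < 4)
  obtain ⟨a₀, ha₀0, ha₀1, ha₀2⟩ := harc _ _ ht1 ht4
  have hne : Nonempty {α : ↥B →ₐ[k] HahnSeries ℚ k // ∀ b ∈ m, 0 < (α b).orderTop} := ⟨a₀⟩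
  obtain ⟨W₃, hW₃, φ₃, k1, -, k3⟩ :=
    (stub_invariance m hm P hPm' hPgen g hg N hN hne 1).mpr ⟨W, hW, φ, h1, h2, h3⟩
  -- a nonzero direction
  obtain ⟨u, hu, hu0⟩ : ∃ u ∈ W₃, u ≠ 0 := by
    by_contra hcon
    push Not at hcon
    have hbot : W₃ = ⊥ := (Submodule.eq_bot_iff _).mpr hcon
    rw [hbot, finrank_bot] at hW₃
    exact absurd hW₃ (by norm_num)
  exact pc_core p P0 P1 P2 hP0m c hc hrel harc P hPP0 hPP1 hPP2 W₃ u hu hu0 φ₃ k1 k3 a₀ ha₀0 ha₀1 ha₀2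

end PCuspMain

end Summit.ResolutionOfSingularities.ResolutionOfSingularities.Theorems

end
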